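import Mathlib
import HarnessLib
import Summits.ResolutionOfSingularities.ResolutionOfSingularities.Theorems.WildQuotientsWildQuotientResolutionS1aKillableTransport

/-!
# S1a — A PRINCIPAL-CENTRE CHART RESTRICTED TO ITSELF: local `G`-stability of the centre and the chart `⊤` of `↑O` (towards G1)

[OURS · L1 W4.5c · lead-1 g8; first half of the support lemma G1 of `…S1aKillableTransport`] — NOT statements of the manuscript; counted 0;
AI-level work, weaker than expert review. Crux stmt-ResolutionOfSingularities-17941, line `s1a-logminvertex` v6. Route-independent.

For an action `ρ` over `q : V → Y`, `G = ⟨g₀⟩` finite, and a principal-centre chart `O` of `(𝒦, d)` (its filtration on `O` is `e⁻¹` of the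
degree-`0` trace, `e` intertwining `g₀` with `σ`):
* `actO_mem_of_isPrincipalCentreChart` — the ideals `𝒦ₙ(O)` are stable under the `g₀`-action on `Γ(V, O)`, hence (`actO_mem_of_forall_pow`,
  `map_actO_eq_of_stable`) under every `g ∈ G`;
* **`comap_restrict_aut_pullbackRees`** — the pulled-back filtration `pullbackRees 𝒦 O.ι` on the open subscheme `↑O` is `G`-STABLE for the
  restricted action `ρ.restrict O` (the hypothesis `hρ` of `IsBlowup.liftAction` / `exists_killedNode_of_isPrincipalCentreChart`);
* `isPrincipalCentreChart_preimage'` — variant of `KillableTransport.isPrincipalCentreChart_preimage` with the two consequences of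
  «iso over the chart» as hypotheses (affine preimage, `appLE` invertible), and **`exists_isPrincipalCentreChart_restrict`** — `⊤ = O.ι⁻¹ O`
  is a principal-centre chart of `(↑O, ρ.restrict O, pullbackRees 𝒦 O.ι, d)`.
-/

set_option linter.dupNamespace false

noncomputable section

open CategoryTheory AlgebraicGeometry TopologicalSpace Topology
open Literature.AlgebraicGeometry.Resolution Literature.AlgebraicGeometry.RelativeSpec
open Summit.ResolutionOfSingularities.ResolutionOfSingularities.Theorems.WildQuotientResolution.S1
open Summit.ResolutionOfSingularities.ResolutionOfSingularities.Theorems.WildQuotientResolution.S1.NodeAtlas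
open Summit.ResolutionOfSingularities.ResolutionOfSingularities.Theorems.WildQuotientResolution.S1.GoodCharts
open Summit.ResolutionOfSingularities.ResolutionOfSingularities.Theorems.WildQuotientResolution.S1.BlowupCharts
open Summit.ResolutionOfSingularities.ResolutionOfSingularities.Theorems.WildQuotientResolution.S1.CoarseChart
open Summit.ResolutionOfSingularities.ResolutionOfSingularities.Theorems.WildQuotientResolution.S1.KillableTransport

namespace Summit.ResolutionOfSingularities.ResolutionOfSingularities.Theorems.WildQuotientResolution.S1.ChartStable

universe u

section Stable

variable {V Y : Scheme.{u}} {q : V ⟶ Y} {G : Type u} [Group G] (ρ : ActionOver q G) (O : ρ.StableAffineOpens) {g₀ : G}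

/-- Stability under `g₀` propagates to its powers. -/
theorem actO_mem_of_forall_pow {J : Ideal Γ(V, O.1)} (hJ : ∀ t ∈ J, actO ρ O g₀ t ∈ J) (k : ℕ) :
    ∀ t ∈ J, actO ρ O (g₀ ^ k) t ∈ J := by
  induction k with
  | zero => intro t ht; rw [pow_zero, actO_one]; exact ht
  | succ k ih => intro t ht; rw [pow_succ', ← actO_actO]; exact hJ _ (ih t ht)

/-- In a finite cyclic group `⟨g₀⟩`, stability under `g₀` is stability under every `g`. -/
theorem actO_mem_of_generator [Finite G] (hG : ∀ g : G, g ∈ Subgroup.zpowers g₀) {J : Ideal Γ(V, O.1)}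
    (hJ : ∀ t ∈ J, actO ρ O g₀ t ∈ J) (g : G) : ∀ t ∈ J, actO ρ O g t ∈ J := by
  obtain ⟨k, rfl⟩ := ((isOfFinOrder_of_finite g₀).mem_powers_iff_mem_zpowers.mpr (hG g))
  exact actO_mem_of_forall_pow ρ O hJ k

/-- A `G`-stable ideal of `Γ(V, O)` is mapped ONTO itself by each `g`. -/
theorem map_actO_eq_of_stable {J : Ideal Γ(V, O.1)} (hJ : ∀ g : G, ∀ t ∈ J, actO ρ O g t ∈ J) (g : G) :
    J.map (actO ρ O g) = J := by
  apply le_antisymm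
  · rw [Ideal.map_le_iff_le_comap]
    exact fun t ht => hJ g t ht
  · intro t ht
    have : t = actO ρ O g (actO ρ O g⁻¹ t) := by rw [actO_actO, mul_inv_cancel, actO_one]
    rw [this]
    exact Ideal.mem_map_of_mem _ (hJ g⁻¹ t ht)

/-- `appLE` along `ρ.aut g` IS `actO g⁻¹` (the tree's convention `actO g := appLE (aut g⁻¹)`). -/
theorem appLE_aut_eq_actO_inv (g : G) : ((ρ.aut g).hom.appLE O.1 O.1 (O.2.1 g).ge).hom = actO ρ O g⁻¹ := by
  have key : ∀ (φ ψ : V ⟶ V) (_ : φ = ψ) (e₁ : O.1 ≤ φ ⁻¹ᵁ O.1) (e₂ : O.1 ≤ ψ ⁻¹ᵁ O.1), φ.appLE O.1 O.1 e₁ = ψ.appLE O.1 O.1 e₂ := by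
    rintro φ _ rfl _ _; rfl
  change ((ρ.aut g).hom.appLE O.1 O.1 (O.2.1 g).ge).hom = ((ρ.aut g⁻¹⁻¹).hom.appLE O.1 O.1 (O.2.1 g⁻¹⁻¹).ge).hom
  exact congrArg CommRingCat.Hom.hom (key _ _ (by rw [inv_inv]) _ _)

/-! ### From the chart data: the centre's ideals on `O` are `g₀`-stable -/

variable {p : ℕ}

/-- **On a principal-centre chart the ideals `𝒦ₙ(O)` are `g₀`-stable** (`e` intertwines `g₀` with `σ`; the trace is `σ`-stable). -/
theorem actO_mem_of_isPrincipalCentreChart {𝒦 : ReesFiltration V} {d : ℕ} (hO : IsPrincipalCentreChart p ρ g₀ 𝒦 d O)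
    (hOaff : IsAffineOpen O.1) (n : ℕ) :
    ∀ t ∈ (𝒦.filtration ⟨O.1, hOaff⟩).ideal n, actO ρ O g₀ t ∈ (𝒦.filtration ⟨O.1, hOaff⟩).ideal n := by
  obtain ⟨hOaff', m, r, B, _, 𝒜, _, σ, e, hnode, hσ, c, f, δ, w, -, -, -, -, -, hσJ, h𝒦, -, -⟩ := hO
  have hK : (𝒦.filtration ⟨O.1, hOaff⟩).ideal n = ((traceFiltration 𝒜 f w).ideal n).comap (e : Γ(V, O.1) →+* ↥(𝒜 0)) := h𝒦 n
  intro t ht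
  rw [hK] at ht ⊢
  have ht' : ((e t : ↥(𝒜 0)) : B) ∈ (weightedFiltration f w).ideal n := ht
  change ((e (actO ρ O g₀ t) : ↥(𝒜 0)) : B) ∈ (weightedFiltration f w).ideal n
  rw [hσ t]
  exact hσJ n (Ideal.mem_map_of_mem _ ht')

/-- … hence `g`-stable for every `g ∈ G = ⟨g₀⟩`. -/
theorem actO_mem_of_isPrincipalCentreChart' [Finite G] (hG : ∀ g : G, g ∈ Subgroup.zpowers g₀) {𝒦 : ReesFiltration V} {d : ℕ}
    (hO : IsPrincipalCentreChart p ρ g₀ 𝒦 d O) (hOaff : IsAffineOpen O.1) (n : ℕ) (g : G) :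
    ∀ t ∈ (𝒦.filtration ⟨O.1, hOaff⟩).ideal n, actO ρ O g t ∈ (𝒦.filtration ⟨O.1, hOaff⟩).ideal n :=
  actO_mem_of_generator ρ O hG (actO_mem_of_isPrincipalCentreChart ρ O hO hOaff n) g

/-! ### The restricted filtration on `↑O` is `G`-stable -/

/-- `appLE` for the restricted action on `Γ(↑O, ⊤)` versus `appLE` for `ρ` on `Γ(V, O)` (naturality along `O.ι`). -/
theorem appLE_restrict_top (g : G) (t : Γ(V, O.1)) :
    ((ρ.restrict O.1 O.2.1).aut g).hom.appLE ⊤ ⊤ le_top (O.1.ι.appLE O.1 ⊤ O.1.ι_preimage_self.ge t) =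
      O.1.ι.appLE O.1 ⊤ O.1.ι_preimage_self.ge ((ρ.aut g).hom.appLE O.1 O.1 (O.2.1 g).ge t) :=
  appLE_comm_of_le ρ (ρ.restrict O.1 O.2.1) (fun g => by rw [ActionOver.restrict_aut_hom, ActionOver.restrictHom_ι]) O.1 O.2.1 ⊤
    (fun _ => rfl) O.1.ι_preimage_self.ge g t

/-- **THE RESTRICTED FILTRATION IS `G`-STABLE**: for a principal-centre chart `O` and `G = ⟨g₀⟩` finite, every piece of `pullbackRees 𝒦 O.ι` is
stable under the restricted action on `↑O`. [OURS · L1 W4.5c] -/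
theorem comap_restrict_aut_pullbackRees [Finite G] (hG : ∀ g : G, g ∈ Subgroup.zpowers g₀) {𝒦 : ReesFiltration V} {d : ℕ}
    (hO : IsPrincipalCentreChart p ρ g₀ 𝒦 d O) (hOaff : IsAffineOpen O.1) (g : G) (n : ℕ) :
    ((pullbackRees 𝒦 O.1.ι).ideal n).comap ((ρ.restrict O.1 O.2.1).aut g).hom = (pullbackRees 𝒦 O.1.ι).ideal n := by
  haveI : IsAffine (O.1 : Scheme.{u}) := hOaff
  -- the two ideal sheaves on the affine `↑O` agree on `⊤`
  apply Scheme.IdealSheafData.ext_of_isAffine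
  let Otop : (O.1 : Scheme.{u}).affineOpens := ⟨⊤, isAffineOpen_top _⟩
  have h1 : (((pullbackRees 𝒦 O.1.ι).ideal n).comap ((ρ.restrict O.1 O.2.1).aut g).hom).ideal Otop =
      (((pullbackRees 𝒦 O.1.ι).ideal n).ideal Otop).map (((ρ.restrict O.1 O.2.1).aut g).hom.appLE ⊤ ⊤ le_top).hom :=
    ideal_comap_of_le ((ρ.restrict O.1 O.2.1).aut g).hom _ Otop Otop le_top
  have h2 : ((pullbackRees 𝒦 O.1.ι).ideal n).ideal Otop =
      ((𝒦.filtration ⟨O.1, hOaff⟩).ideal n).map (O.1.ι.appLE O.1 ⊤ O.1.ι_preimage_self.ge).hom := by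
    rw [pullbackRees_ideal, ReesFiltration.filtration_ideal]
    exact ideal_comap_of_le O.1.ι (𝒦.ideal n) ⟨O.1, hOaff⟩ Otop O.1.ι_preimage_self.ge
  change (((pullbackRees 𝒦 O.1.ι).ideal n).comap ((ρ.restrict O.1 O.2.1).aut g).hom).ideal Otop = ((pullbackRees 𝒦 O.1.ι).ideal n).ideal Otop
  rw [h1, h2, Ideal.map_map]
  -- `appLE (aut₀ g) ∘ ψ = ψ ∘ appLE (aut g)` on `Γ(V, O)`
  have hcomm : (((ρ.restrict O.1 O.2.1).aut g).hom.appLE ⊤ ⊤ le_top).hom.comp (O.1.ι.appLE O.1 ⊤ O.1.ι_preimage_self.ge).hom =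
      (O.1.ι.appLE O.1 ⊤ O.1.ι_preimage_self.ge).hom.comp ((ρ.aut g).hom.appLE O.1 O.1 (O.2.1 g).ge).hom :=
    RingHom.ext fun t => appLE_restrict_top ρ O g t
  rw [hcomm, ← Ideal.map_map, appLE_aut_eq_actO_inv,
    map_actO_eq_of_stable ρ O (actO_mem_of_isPrincipalCentreChart' ρ O hG hO hOaff n) g⁻¹]

end Stable

/-! ## The chart `⊤` of the open subscheme `↑O` -/

section Restrict

variable {V' V Y : Scheme.{u}} {q : V ⟶ Y} {r' : V' ⟶ Y} {G : Type u} [Group G] (ρ : ActionOver q G) (ρ' : ActionOver r' G)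
  (π' : V' ⟶ V) (hr' : r' = π' ≫ q) (hcomm : ∀ g : G, (ρ'.aut g).hom ≫ π' = π' ≫ (ρ.aut g).hom) {p : ℕ} (g₀ : G)

include hr' hcomm in
/-- **Variant of `isPrincipalCentreChart_preimage`** with «iso over the chart» replaced by its two consequences: the preimage is affine and
`π'.appLE O (π'⁻¹O)` is invertible. [OURS · L1 W4.5c] -/
theorem isPrincipalCentreChart_preimage' (𝒦 : ReesFiltration V) (d : ℕ) (O : ρ.StableAffineOpens)
    (hkill : IsPrincipalCentreChart p ρ g₀ 𝒦 d O) (hO' : IsAffineOpen (π' ⁻¹ᵁ O.1)) [IsIso (π'.appLE O.1 (π' ⁻¹ᵁ O.1) le_rfl)] :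
    ∃ O' : ρ'.StableAffineOpens, O'.1 = π' ⁻¹ᵁ O.1 ∧ IsPrincipalCentreChart p ρ' g₀ (pullbackRees 𝒦 π') d O' := by
  obtain ⟨hO, m, r, B, _, 𝒜, _, σ, e, htame, hσ, c, f, δ, w, hc, hf, hw, hK1, hK1', hσJ, h𝒦, hver, hprin⟩ := hkill
  have hstab : ∀ g : G, (ρ'.aut g).hom ⁻¹ᵁ (π' ⁻¹ᵁ O.1) = π' ⁻¹ᵁ O.1 := preimage_stable ρ ρ' π' hcomm O.1 O.2.1
  haveI : IsAffineHom ((π' ⁻¹ᵁ O.1).ι ≫ r') := by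
    rw [hr', ← Category.assoc, ← morphismRestrict_ι, Category.assoc]
    haveI := O.2.2
    haveI : IsAffine (O.1 : Scheme.{u}) := hO
    haveI : IsAffine ((π' ⁻¹ᵁ O.1 : V'.Opens) : Scheme.{u}) := hO'
    infer_instance
  let O' : ρ'.StableAffineOpens := ⟨π' ⁻¹ᵁ O.1, hstab, inferInstance⟩
  obtain ⟨P, hPapply⟩ : ∃ P : Γ(V, O.1) ≃+* Γ(V', π' ⁻¹ᵁ O.1), ∀ s, P s = π'.appLE O.1 (π' ⁻¹ᵁ O.1) le_rfl s :=
    ⟨(asIso (π'.appLE O.1 (π' ⁻¹ᵁ O.1) le_rfl)).commRingCatIsoToRingEquiv, fun _ => rfl⟩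
  refine ⟨O', rfl, hO', m, r, B, inferInstance, 𝒜, inferInstance, σ, P.symm.trans e, htame, fun t => ?_, c, f, δ, w, hc, hf, hw, hK1, hK1', hσJ,
    fun n => ?_, hver, hprin⟩
  · obtain ⟨s, rfl⟩ := P.surjective t
    have h1 : (ρ'.aut g₀⁻¹).hom.appLE (π' ⁻¹ᵁ O.1) (π' ⁻¹ᵁ O.1) (hstab g₀⁻¹).ge (P s) =
        P ((ρ.aut g₀⁻¹).hom.appLE O.1 O.1 (O.2.1 g₀⁻¹).ge s) := by
      rw [hPapply, hPapply]
      exact appLE_comm_of_le ρ ρ' hcomm O.1 O.2.1 (π' ⁻¹ᵁ O.1) hstab le_rfl g₀⁻¹ s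
    change (((P.symm.trans e) ((ρ'.aut g₀⁻¹).hom.appLE (π' ⁻¹ᵁ O.1) (π' ⁻¹ᵁ O.1) (hstab g₀⁻¹).ge (P s)) : ↥(𝒜 0)) : B) =
      σ (((P.symm.trans e) (P s) : ↥(𝒜 0)) : B)
    rw [RingEquiv.trans_apply, RingEquiv.trans_apply, h1, P.symm_apply_apply, P.symm_apply_apply]
    exact hσ s
  · rw [ReesFiltration.filtration_ideal, pullbackRees_ideal,
      ideal_comap_of_le π' (𝒦.ideal n) ⟨O.1, hO⟩ ⟨π' ⁻¹ᵁ O.1, hO'⟩ le_rfl, ← ReesFiltration.filtration_ideal, h𝒦 n]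
    have hPhom : (π'.appLE O.1 (π' ⁻¹ᵁ O.1) le_rfl).hom = (P : Γ(V, O.1) →+* Γ(V', π' ⁻¹ᵁ O.1)) := RingHom.ext fun s => (hPapply s).symm
    rw [hPhom, Ideal.map_comap_of_equiv]
    exact Ideal.ext fun _ => Iff.rfl

end Restrict

section RestrictTop

variable {V Y : Scheme.{u}} {q : V ⟶ Y} {G : Type u} [Group G] (ρ : ActionOver q G) {p : ℕ} (g₀ : G)

/-- `O.ι.appLE O (O.ι⁻¹ O)` is invertible. -/
theorem isIso_ι_appLE (O : V.Opens) : IsIso (O.ι.appLE O (O.ι ⁻¹ᵁ O) le_rfl) := by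
  rw [← Scheme.Hom.app_eq_appLE]
  exact O.ι.isIso_app O (by rw [Scheme.Opens.opensRange_ι])

/-- **THE CHART `⊤ = O.ι⁻¹ O` OF `↑O`** is a principal-centre chart of `(↑O, ρ.restrict O, pullbackRees 𝒦 O.ι, d)`. [OURS · L1 W4.5c] -/
theorem exists_isPrincipalCentreChart_restrict (𝒦 : ReesFiltration V) (d : ℕ) (O : ρ.StableAffineOpens)
    (hkill : IsPrincipalCentreChart p ρ g₀ 𝒦 d O) :
    ∃ O₀ : (ρ.restrict O.1 O.2.1).StableAffineOpens, O₀.1 = O.1.ι ⁻¹ᵁ O.1 ∧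
      IsPrincipalCentreChart p (ρ.restrict O.1 O.2.1) g₀ (pullbackRees 𝒦 O.1.ι) d O₀ := by
  haveI := isIso_ι_appLE O.1
  have hO' : IsAffineOpen (O.1.ι ⁻¹ᵁ O.1) := by
    rw [O.1.ι_preimage_self]
    haveI : IsAffine (O.1 : Scheme.{u}) := hkill.1
    exact isAffineOpen_top _
  exact isPrincipalCentreChart_preimage' ρ (ρ.restrict O.1 O.2.1) O.1.ι rfl
    (fun g => by rw [ActionOver.restrict_aut_hom, ActionOver.restrictHom_ι]) g₀ 𝒦 d O hkill hO'

end RestrictTop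

end Summit.ResolutionOfSingularities.ResolutionOfSingularities.Theorems.WildQuotientResolution.S1.ChartStable

end
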